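import Literature.NumberTheory.Automorphic.LanglandsTetrahedralJacquetShalikaAnalyticLeaves
import Literature.NumberTheory.Automorphic.PairLFunctionPolesRepDataHolds
import Literature.NumberTheory.Automorphic.AutomorphicTwistNorm
import Literature.NumberTheory.Automorphic.ClozelAlgebraicityComplexConjProofs
import Literature.NumberTheory.Automorphic.IdeleNormDetGL
import HarnessLib

/-!
# `JacquetShalika_eq_of_rsData_eq` (Gelbart 1997, Thm. 5.3.3 as used on p. 257) from
# Arthur–Clozel (2.2)–(2.3) **for Borel–Jacquet data**

Topic `NumberTheory/Automorphic`; namespace `Literature.NumberTheory.Automorphic`. Proof file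
(theorems only: no definition, no named fact, no instance, no `sorry`), fifth sibling of
`LanglandsTetrahedral` under the named fact `JacquetShalika_eq_of_rsData_eq` (two cuspidal
automorphic representations `Π, Π'` of `GL_n(𝔸_F)` — Borel–Jacquet data, arbitrary central
characters — whose local Rankin–Selberg data `{α'_i / α_j} = {α_i / α_j}` agree at almost every place
have the same Satake parameters at almost every place; Gelbart, *Three lectures …*, in
Cornell–Silverman–Stevens (1997), Thm. 5.3.3 (Jacquet–Shalika 1981) in the form used in §7.1,
p. 257: "by Theorem 5.3.3, `L(s, Π₁ × Π̃₁)` has a pole at `s = 1` … therefore `L(s, Π₁* × Π̃₁)` also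
has a pole at `s = 1` … and this in turn implies (by the same Theorem 5.3.3) that `Π₁* ≅ Π₁`").

The earlier siblings (`LanglandsTetrahedralProofs`, `…Leaves`, `…JacquetShalikaLeaves`,
`…JacquetShalikaAnalyticLeaves`) prove the fact from the three **`L²` leaves**
`JacquetShalika1981_partialPairL_at_one_of_ne_conj`, `…_pole_of_eq_conj` (Arthur–Clozel, Ch. 3,
(2.2) at `s = 1` and (2.3), for closed irreducible subspaces of `L²_cusp(GL_n(K) A_G \ GL_n(𝔸_K))`,
every rank, field and automorphic measure) and `multiplicity_one_gl`. This file proves it instead,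
in a dozen lines of analysis, from the two **Borel–Jacquet-model** named facts of
`PairLFunctionPolesRepData` — the currency in which the other consumers of Jacquet–Shalika in the
tree (`RamakrishnanMultiplicityOneLemma414`, `BockleHuiIrreducibleGL3AnalyticProofs`,
`HeckeCharacterPairRigidity`, …) are written:

* `JacquetShalika1981_partialPairL_boundary_repData` — (2.2): off the set `X` (Hecke-matrix form
  "`q_w^{1-s₀} t_{π,w} = t_{σ,w}⁻¹` a.e."), `L^S(s, π ⊗ σ)` has a finite non-zero limit at `s₀`,
  `Re s₀ = 1`; used only at `s₀ = 1` for `n = m`, and only its finiteness;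
* `JacquetShalika1981_partialPairL_pole_repData` — (2.3): on `X`, `(s - s₀) L^S(s, π ⊗ σ) → c ≠ 0`;
  used only at `s₀ = 1`.

Neither multiplicity one nor any `L²` statement is visible any more: the exceptional set `X` of the
Borel–Jacquet facts is *literally* the conclusion "same Satake parameters almost everywhere" of the
fact, which is why Gelbart can write "`Π₁* ≅ Π₁`" and the tree "`t_{Π₁*,v} = t_{Π₁,v}` a.e." for the
same thing.

## The proof (`JacquetShalika_eq_of_rsData_eq_of_boundary_of_pole_repData`)

Gelbart's p. 257 verbatim, preceded by the normalisation "we may assume `Π` unitary"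
(Borel–Jacquet 1979, 5.7; Arthur–Clozel, proof of Thm. 3.1), all of whose ingredients are THEOREMS
of the tree:

1. *Exact Satake families.* `t_{Π,w} = q_w^{s} a(w)`, `t_{Π',w} = q_w^{s'} a'(w)` off finite sets,
   with `a`, `a'` Satake families of cuspidal `L²` representations — hence `|∏ a(w)| = 1`
   (`HasSatakeParameterAt.norm_prod_eq_one`) and `\bar a(w) = a(w)⁻¹` as multisets
   (`HasSatakeParameterAt.map_conj_inv_eq`) — and *no other* Satake parameters there
   (`CuspidalAutomorphicRepData.exists_satake_eq_cpow_mul_L2_of_holds`, Harish-Chandra + Knapp–Vogan,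
   `LanglandsTetrahedralJacquetShalikaAnalyticLeaves`).
2. *Twist both by `|det|^{s}`* (`exists_cuspidalAutomorphicRepData_map_mulChar_detTwist`,
   `HasSatakeParamAt.of_map_mulChar_detTwist_of_cpow`: `t_{π ⊗ |det|^s} = q^{-s} t_π`): `Π₁ = Π ⊗ |det|^s`
   has exact family `a`, `Π₁' = Π' ⊗ |det|^s` has exact family `b = q^{s'-s} a'`. The hypothesis
   `rsData t_{Π'} t_Π = rsData t_Π t_Π` reads `rsData b a = rsData a a` off a finite set; taking
   determinants and absolute values at one place, `re (s' - s) = 0` (`re_eq_zero_of_map_pow_eq_shift`),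
   so `b` is unitary too.
3. *The contragredient is the conjugate.* `Π̄₁` (`CuspidalAutomorphicRepData.conj`, Clozel's `^cπ`,
   `HasSatakeParamAt.conj`) has family `\bar a = a⁻¹`, so the Euler factors of `L^S(s, Π₁' × Π̄₁)` and
   `L^S(s, Π₁ × Π̄₁)` are `det(1 - rsData(b, a) q^{-s})⁻¹ = det(1 - rsData(a, a) q^{-s})⁻¹`: **the two
   partial `L`-functions coincide** ("`L(s, Π*_{1,v} × Π̃_{1,v}) = L(s, Π_{1,v} × Π̃_{1,v})` for all
   `v` outside `S`").
4. *(2.3)*: `a = (\bar a)⁻¹` everywhere off `S`, so `(s - 1) L^S(s, Π₁ × Π̄₁) → c ≠ 0`: no finite limit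
   at `1` ("has a pole at `s = 1`").
5. *(2.2)* for `(Π₁', Π̄₁)` at `s₀ = 1`: unless `b = (\bar a)⁻¹ = a` almost everywhere, `L^S(s, Π₁' × Π̄₁)`
   would have a finite limit at `1` — absurd by 3–4. Hence `b = a` a.e., i.e.
   `t_{Π',w} = q_w^{s} b(w) = q_w^{s} a(w) = t_{Π,w}` for almost all `w` ("`Π₁* ≅ Π₁`").

Rank `0` is trivial (all parameters are `∅`).

## Main statements

* `JacquetShalika_eq_of_rsData_eq_of_boundary_of_pole_repData` — the fact from the two Borel–Jacquet
  named facts (2.2), (2.3) of `PairLFunctionPolesRepData`;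
* `JacquetShalika_eq_of_rsData_eq_of_boundary_repData_of_pole_of_eq_conj` — the same with (2.3)
  replaced by its single `L²` leaf `JacquetShalika1981_partialPairL_pole_of_eq_conj` (through the
  landed `JacquetShalika1981_partialPairL_pole_repData_of_pole_of_eq_conj`).

So the discharge `JacquetShalika_eq_of_rsData_eq_holds` is
`JacquetShalika_eq_of_rsData_eq_of_boundary_of_pole_repData` applied to the two `_holds` of
`PairLFunctionPolesRepData`, whenever they land. No statement of the tree is modified; nothing here
restates or weakens a vendored fact; no named fact is introduced.

## References

* S. Gelbart, *Three lectures on the modularity of `ρ̄_{E,3}` and the Langlands reciprocity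
  conjecture*, in *Modular forms and Fermat's last theorem* (1997), Thm. 5.3.3, §7.1 pp. 254–257
  [Gelbart1997].
* H. Jacquet, J. A. Shalika, *On Euler products and the classification of automorphic forms II*,
  Amer. J. Math. 103 (1981), 777–815, Prop. 3.6, Thm. 4.4 [JacquetShalikaAJM1981II].
* J. Arthur, L. Clozel, *Simple algebras, base change, and the advanced theory of the trace
  formula*, Ann. of Math. Stud. 120 (1989), Ch. 3 §2 (2.2)–(2.3), p. 171, and proof of Thm. 3.1
  [ArthurClozelAMS120].
* A. Borel, H. Jacquet, *Automorphic forms and automorphic representations*, Proc. Sympos. Pure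
  Math. 33 (1979), part 1, §4.6 and 5.7 [BorelJacquetCorvallis1979].
-/

noncomputable section

open scoped MatrixGroups NNReal Classical
open NumberField IsDedekindDomain MeasureTheory Filter Topology

namespace Literature.NumberTheory.Automorphic

open AdelicGroupData
open Literature.NumberTheory.GaloisRepresentations (HeckeCharacter ideleGroup ideleNorm)

/-! ### Multiset bookkeeping -/

section Bookkeeping

/-- `#(rsData β' β) = #β' · #β`. [folklore] -/
private theorem card_rsData_rd (β' β : Multiset ℂ) :
    Multiset.card (rsData β' β) = Multiset.card β' * Multiset.card β := by
  rw [rsData, Multiset.card_map, Multiset.card_product]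

/-- Scaling the first argument of `rsData`: `rsData (c β') β = c · rsData β' β`. [folklore] -/
private theorem rsData_map_mul_left (β' β : Multiset ℂ) (c : ℂ) :
    rsData (β'.map (c * ·)) β = (rsData β' β).map (c * ·) := by
  have h := rsData_map_mul_map_mul β' β c 1
  rwa [inv_one, mul_one, map_one_mul] at h

/-- `q^{a} (q^{b} x) = q^{a + b} x` inside a `Multiset.map`. [folklore] -/
private theorem map_cpow_mul_map_cpow_mul {q : ℂ} (hq : q ≠ 0) (a b : ℂ) (M : Multiset ℂ) :
    (M.map ((q ^ b) * ·)).map ((q ^ a) * ·) = M.map ((q ^ (a + b)) * ·) := by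
  rw [Multiset.map_map]
  refine Multiset.map_congr rfl fun x _ => ?_
  rw [Function.comp_apply, ← mul_assoc, ← Complex.cpow_add _ _ hq]

/-- `q^{-s} (q^{s} x) = x` inside a `Multiset.map`. [folklore] -/
private theorem map_cpow_neg_mul_map_cpow_mul {q : ℂ} (hq : q ≠ 0) (s : ℂ) (M : Multiset ℂ) :
    (M.map ((q ^ s) * ·)).map ((q ^ (-s)) * ·) = M := by
  rw [map_cpow_mul_map_cpow_mul hq, neg_add_cancel, Complex.cpow_zero, map_one_mul]

end Bookkeeping

/-! ### Satake parameters of a norm twist, exactly -/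

section Twist

variable {n : ℕ} {K : Type} [Field K] [NumberField K] {hK : isCompact_glFiniteIntegralLevel n K}

/-- **Satake parameters of `π ⊗ |det|^{s}`, both ways.** If `π'` is the `|det|_𝔸^{s}`-twist of the
Borel–Jacquet datum `π` (`W_{π'} = |det|^s · W_π`, `W'_{π'} = |det|^s · W'_π`), then `π'` has Satake
parameter `β` at `v` iff `π` has Satake parameter `q_v^{s} β` there
(`HasSatakeParamAt.of_map_mulChar_detTwist_of_cpow` for `|det|^{s}` and for the inverse twist
`|det|^{-s}`, `W_π = |det|^{-s} · W_{π'}`). Borel–Jacquet 1979, 5.7; Arthur–Clozel, Ch. 3, proof of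
Thm. 3.1 (`t_{π ⊗ η} = η(ϖ) t_π`). [cite: BorelJacquetCorvallis1979, 5.7] -/
theorem AutomorphicRepData.hasSatakeParamAt_iff_of_map_mulChar_detTwist_of_cpow
    {χ : HeckeCharacter K} {s : ℂ}
    (hχ : ∀ x : ideleGroup K, ((χ x : ℂˣ) : ℂ) = (ideleNorm x : ℂ) ^ s)
    {π π' : AutomorphicRepData (AutomorphyDatum.gl n K hK)}
    (hW : π'.W = π.W.map (mulChar (detTwist n χ)))
    (hW' : π'.W' = π.W'.map (mulChar (detTwist n χ)))
    (v : HeightOneSpectrum (𝓞 K)) (β : Multiset ℂ) :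
    π'.HasSatakeParamAt v β ↔
      π.HasSatakeParamAt v (β.map (((v.residueCard : ℂ) ^ s) * ·)) := by
  have hq : (v.residueCard : ℂ) ≠ 0 := by
    have := v.one_lt_residueCard
    exact_mod_cast (by omega : v.residueCard ≠ 0)
  constructor
  · intro h
    have hV : π.W = π'.W.map (mulChar (detTwist n χ⁻¹)) := by
      rw [detTwist_inv, hW, map_mulChar_inv_map_mulChar]
    have hV' : π.W' = π'.W'.map (mulChar (detTwist n χ⁻¹)) := by
      rw [detTwist_inv, hW', map_mulChar_inv_map_mulChar]
    have h2 := AutomorphicRepData.HasSatakeParamAt.of_map_mulChar_detTwist_of_cpow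
      (inv_apply_of_cpow hχ) hV hV' h
    simp only [neg_neg] at h2
    exact h2
  · intro h
    have h2 := AutomorphicRepData.HasSatakeParamAt.of_map_mulChar_detTwist_of_cpow hχ hW hW' h
    rwa [map_cpow_neg_mul_map_cpow_mul hq] at h2

end Twist

/-! ### The fact from (2.2)–(2.3) for Borel–Jacquet data -/

section Main

/-- **`JacquetShalika_eq_of_rsData_eq` from Arthur–Clozel (2.2)–(2.3) for Borel–Jacquet data**
(`JacquetShalika1981_partialPairL_boundary_repData`, `JacquetShalika1981_partialPairL_pole_repData` of
`PairLFunctionPolesRepData`; Jacquet–Shalika II, Prop. 3.6). For cuspidal `Π, Π'` on `GL_n(𝔸_F)`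
(Borel–Jacquet data, arbitrary central characters) with `rsData t_{Π',v} t_{Π,v} = rsData t_{Π,v} t_{Π,v}`
for almost all `v`: normalise `t_Π = q^{s} a`, `t_{Π'} = q^{s'} a'` by exact unitary families
(`CuspidalAutomorphicRepData.exists_satake_eq_cpow_mul_L2_of_holds`), twist both by `|det|^{s}`
(`Π₁`, `Π₁'` with exact families `a`, `b = q^{s'-s} a'`, `re (s' - s) = 0` by unitarity at one place),
and compare against the conjugate `Π̄₁` (family `\bar a = a⁻¹`): the Euler factors of
`L^S(s, Π₁' × Π̄₁)` and `L^S(s, Π₁ × Π̄₁)` coincide, the latter has a pole at `s = 1` by (2.3), so by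
(2.2) at `s₀ = 1` the exceptional relation `b = a` holds almost everywhere, i.e. `t_{Π'} = t_Π` a.e.
This is Gelbart's p. 257: "`L(s, Π₁ × Π̃₁)` has a pole at `s = 1` … `L(s, Π*_{1,v} × Π̃_{1,v}) =
L(s, Π_{1,v} × Π̃_{1,v})` outside `S` … therefore `L(s, Π₁* × Π̃₁)` also has a pole at `s = 1` … (by the
same Theorem 5.3.3) `Π₁* ≅ Π₁`". [cite: Gelbart1997, Thm. 5.3.3 and §7.1 p. 257]
[cite: ArthurClozelAMS120, Ch. 3 §2 (2.2)–(2.3), p. 171] [cite: JacquetShalikaAJM1981II, Prop. 3.6]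
[cite: BorelJacquetCorvallis1979, 5.7] -/
theorem JacquetShalika_eq_of_rsData_eq_of_boundary_of_pole_repData
    (h22 : JacquetShalika1981_partialPairL_boundary_repData)
    (h23 : JacquetShalika1981_partialPairL_pole_repData) :
    JacquetShalika_eq_of_rsData_eq := by
  intro n F _ _ hF P P' hyp
  rcases Nat.eq_zero_or_pos n with hn0 | hn
  · -- `GL_0`: all Satake parameters are the empty multiset
    subst hn0
    refine Filter.Eventually.of_forall fun w α α' hα hα' => ?_
    rw [Multiset.card_eq_zero.1 hα.card_eq, Multiset.card_eq_zero.1 hα'.card_eq]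
  haveI : NeZero n := ⟨hn.ne'⟩
  haveI := infinite_heightOneSpectrum F
  obtain ⟨μm, hμm⟩ := AdelicGroupData.exists_isAutomorphicMeasure_gl_holds n F
  haveI := hμm
  have hq0 : ∀ w : HeightOneSpectrum (𝓞 F), 0 < w.residueCard := fun w => by
    have := w.one_lt_residueCard
    omega
  have hq : ∀ w : HeightOneSpectrum (𝓞 F), (w.residueCard : ℂ) ≠ 0 := fun w => by
    exact_mod_cast (hq0 w).ne'
  have hqs : ∀ (w : HeightOneSpectrum (𝓞 F)) (t : ℂ), (w.residueCard : ℂ) ^ t ≠ 0 :=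
    fun w t h0 => hq w ((Complex.cpow_eq_zero_iff _ _).1 h0).1
  -- Step 1: exact unitary Satake families `t_Π = q^{s} a`, `t_{Π'} = q^{s'} a'`
  obtain ⟨s, Q, S, a, hS, haQ, hiff⟩ :=
    CuspidalAutomorphicRepData.exists_satake_eq_cpow_mul_L2_of_holds hF μm P
  obtain ⟨s', Q', S', a', hS', haQ', hiff'⟩ :=
    CuspidalAutomorphicRepData.exists_satake_eq_cpow_mul_L2_of_holds hF μm P'
  have hu1 : ∀ w ∉ S, ‖(a w).prod‖ = 1 := fun w hw => by
    obtain ⟨𝔫, -, -, ϖ, hSat⟩ := haQ w hw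
    exact hSat.norm_prod_eq_one
  have hu1' : ∀ w ∉ S', ‖(a' w).prod‖ = 1 := fun w hw => by
    obtain ⟨𝔫, -, -, ϖ, hSat⟩ := haQ' w hw
    exact hSat.norm_prod_eq_one
  have hinvconj : ∀ w ∉ S, ((a w).map (starRingEnd ℂ)).map (·⁻¹) = a w := fun w hw => by
    obtain ⟨𝔫, h𝔫, hw𝔫, ϖ, hSat⟩ := haQ w hw
    rw [Multiset.map_map]
    exact hSat.map_conj_inv_eq h𝔫 hw𝔫
  -- Step 2: twist `Π`, `Π'` by `|det|^{s}`; exact families `a` and `b = q^{s'-s} a'`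
  obtain ⟨χ, hχ⟩ := exists_heckeCharacter_ideleNorm_cpow F s
  obtain ⟨P₁, hW₁, hW₁'⟩ := exists_cuspidalAutomorphicRepData_map_mulChar_detTwist hχ P
  obtain ⟨P₁', hV₁, hV₁'⟩ := exists_cuspidalAutomorphicRepData_map_mulChar_detTwist hχ P'
  obtain ⟨b, hb⟩ : ∃ b : SatakeFamily F,
      ∀ w, b w = (a' w).map (((w.residueCard : ℂ) ^ (s' - s)) * ·) := ⟨_, fun _ => rfl⟩
  obtain ⟨g, hg⟩ : ∃ g : SatakeFamily F, ∀ w, g w = (a w).map (starRingEnd ℂ) := ⟨_, fun _ => rfl⟩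
  have hiff₁ : ∀ w ∉ S, ∀ β : Multiset ℂ, P₁.1.HasSatakeParamAt w β ↔ β = a w := by
    intro w hw β
    rw [AutomorphicRepData.hasSatakeParamAt_iff_of_map_mulChar_detTwist_of_cpow hχ hW₁ hW₁' w β,
      hiff w hw]
    constructor
    · intro h
      have h' := congrArg (Multiset.map (((w.residueCard : ℂ) ^ (-s)) * ·)) h
      rwa [map_cpow_neg_mul_map_cpow_mul (hq w), map_cpow_neg_mul_map_cpow_mul (hq w)] at h'
    · intro h
      rw [h]
  have hiff₁' : ∀ w ∉ S', ∀ β : Multiset ℂ, P₁'.1.HasSatakeParamAt w β ↔ β = b w := by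
    intro w hw β
    rw [AutomorphicRepData.hasSatakeParamAt_iff_of_map_mulChar_detTwist_of_cpow hχ hV₁ hV₁' w β,
      hiff' w hw, hb w]
    constructor
    · intro h
      have h' := congrArg (Multiset.map (((w.residueCard : ℂ) ^ (-s)) * ·)) h
      rwa [map_cpow_neg_mul_map_cpow_mul (hq w), map_cpow_mul_map_cpow_mul (hq w),
        neg_add_eq_sub] at h'
    · intro h
      rw [h, map_cpow_mul_map_cpow_mul (hq w), add_sub_cancel]
  -- Step 3: the finite exceptional sets
  obtain ⟨S₀, hS₀, H23⟩ := h23 n F hF hn P₁ P₁.conj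
  obtain ⟨S₀', hS₀', H22⟩ := h22 n n F hF hF hn hn P₁' P₁.conj
  set E : Set (HeightOneSpectrum (𝓞 F)) := {w | ¬ ∀ α α' : Multiset ℂ,
      P.1.HasSatakeParamAt w α → P'.1.HasSatakeParamAt w α' → rsData α' α = rsData α α} with hE
  have hEfin : E.Finite := Filter.eventually_cofinite.1 hyp
  set U : Set (HeightOneSpectrum (𝓞 F)) := (S ∪ S' ∪ E) ∪ (S₀ ∪ S₀') with hU
  have hUfin : U.Finite := ((hS.union hS').union hEfin).union (hS₀.union hS₀')
  have hSU : S ⊆ U := fun w hw => Or.inl (Or.inl (Or.inl hw))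
  have hS'U : S' ⊆ U := fun w hw => Or.inl (Or.inl (Or.inr hw))
  have hEU : E ⊆ U := fun w hw => Or.inl (Or.inr hw)
  have hS₀U : S₀ ⊆ U := fun w hw => Or.inr (Or.inl hw)
  have hS₀'U : S₀' ⊆ U := fun w hw => Or.inr (Or.inr hw)
  -- the hypothesis off `U`: `q^{s'-s} rsData a' a = rsData a a`
  have hrel0 : ∀ w ∉ U, (rsData (a' w) (a w)).map (((w.residueCard : ℂ) ^ (s' - s)) * ·) =
      rsData (a w) (a w) := by
    intro w hw
    have hwE : w ∉ E := fun h => hw (hEU h)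
    simp only [hE, Set.mem_setOf_eq, not_not] at hwE
    have h := hwE _ _ ((hiff w (fun h => hw (hSU h)) _).2 rfl)
      ((hiff' w (fun h => hw (hS'U h)) _).2 rfl)
    have hc : (w.residueCard : ℂ) ^ s' * ((w.residueCard : ℂ) ^ s)⁻¹ =
        (w.residueCard : ℂ) ^ (s' - s) := by
      rw [Complex.cpow_sub _ _ (hq w), div_eq_mul_inv]
    rwa [rsData_map_mul_map_mul, rsData_map_mul_map_mul, hc, mul_inv_cancel₀ (hqs w s),
      map_one_mul] at h
  -- Step 4: `re (s' - s) = 0`, by unitarity at one place off `U`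
  obtain ⟨w₀, hw₀⟩ := hUfin.infinite_compl.nonempty
  have hre : (s' - s).re = 0 := by
    have hrel := hrel0 w₀ hw₀
    have hw₀S : w₀ ∉ S := fun h => hw₀ (hSU h)
    have hw₀S' : w₀ ∉ S' := fun h => hw₀ (hS'U h)
    have hn1 : ‖(rsData (a w₀) (a w₀)).prod‖ = 1 := by
      rw [prod_rsData, norm_mul, norm_pow, norm_pow, norm_inv, hu1 w₀ hw₀S]
      simp
    have hn1' : ‖(rsData (a' w₀) (a w₀)).prod‖ = 1 := by
      rw [prod_rsData, norm_mul, norm_pow, norm_pow, norm_inv, hu1 w₀ hw₀S, hu1' w₀ hw₀S']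
      simp
    refine re_eq_zero_of_map_pow_eq_shift (f := 1) w₀.one_lt_residueCard one_pos ?_ hn1 hn1' ?_
    · rw [card_rsData_rd, haQ'.card_eq hw₀S', haQ.card_eq hw₀S]
      exact Nat.mul_ne_zero hn.ne' hn.ne'
    · rw [hrel]
  -- the three families off `U`: `a` of `Π₁`, `b` of `Π₁'`, `ḡ = \bar a` of `Π̄₁`, all unitary
  have hfa : ∀ w ∉ U, P₁.1.HasSatakeParamAt w (a w) := fun w hw =>
    (hiff₁ w (fun h => hw (hSU h)) _).2 rfl
  have hfb : ∀ w ∉ U, P₁'.1.HasSatakeParamAt w (b w) := fun w hw =>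
    (hiff₁' w (fun h => hw (hS'U h)) _).2 rfl
  have hfg : ∀ w ∉ U, P₁.conj.1.HasSatakeParamAt w (g w) := fun w hw => by
    rw [hg w, CuspidalAutomorphicRepData.conj_val]
    exact (hfa w hw).conj
  have hua : ∀ w ∉ U, ‖(a w).prod‖ = 1 := fun w hw => hu1 w (fun h => hw (hSU h))
  have hug : ∀ w ∉ U, ‖(g w).prod‖ = 1 := fun w hw => by
    rw [hg w, ← map_multiset_prod, Complex.norm_conj]
    exact hua w hw
  have hub : ∀ w ∉ U, ‖(b w).prod‖ = 1 := fun w hw => by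
    rw [hb w, prod_map_const_mul_eq, norm_mul, norm_pow, Complex.norm_natCast_cpow_of_pos (hq0 w),
      hre, Real.rpow_zero, one_pow, one_mul]
    exact hu1' w (fun h => hw (hS'U h))
  -- Step 5: the Euler factors of `(Π₁', Π̄₁)` and `(Π₁, Π̄₁)` agree off `U`
  have hfac : ∀ w ∉ U, satakePairPolynomial (b w) (g w) = satakePairPolynomial (a w) (g w) := by
    intro w hw
    have hwS : w ∉ S := fun h => hw (hSU h)
    rw [satakePairPolynomial_eq_eulerPolynomial, satakePairPolynomial_eq_eulerPolynomial, hg w,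
      ← haQ.map_inv_eq_map_conj hwS, ← rsData_eq_satakeTensor_map_inv,
      ← rsData_eq_satakeTensor_map_inv, hb w, rsData_map_mul_left, hrel0 w hw]
  have hLL : partialPairL U b g = partialPairL U a g := by
    funext z
    simp only [partialPairL]
    exact tprod_congr fun w => by rw [hfac w.1 w.2]
  -- Step 6: (2.3) for `(Π₁, Π̄₁)` at `s₀ = 1`: a pole, hence no finite limit
  have hXa : ∀ᶠ w : HeightOneSpectrum (𝓞 F) in cofinite,
      (a w).map (((w.residueCard : ℂ) ^ (1 - (1 : ℂ))) * ·) = (g w).map (·⁻¹) := by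
    filter_upwards [hS.compl_mem_cofinite] with w hw
    rw [sub_self, Complex.cpow_zero, hg w, hinvconj w hw, map_one_mul]
  obtain ⟨c, hc, hpole⟩ := H23 hUfin hS₀U hfa hfg hua hug Complex.one_re hXa
  have hnolim : ∀ d : ℂ, ¬ Tendsto (partialPairL U a g) (𝓝[{z : ℂ | 1 < z.re}] 1) (𝓝 d) := by
    intro d hd
    have h0 : Tendsto (fun z => (z - 1) * partialPairL U a g z) (𝓝[{z : ℂ | 1 < z.re}] 1)
        (𝓝 (0 * d)) :=
      tendsto_sub_one_nhdsWithin_one_lt_re.mul hd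
    rw [zero_mul] at h0
    exact hc (tendsto_nhds_unique hpole h0)
  -- Step 7: (2.2) for `(Π₁', Π̄₁)` at `s₀ = 1` forces the exceptional relation `b = a` a.e.
  have hXb : ∀ᶠ w : HeightOneSpectrum (𝓞 F) in cofinite,
      (b w).map (((w.residueCard : ℂ) ^ (1 - (1 : ℂ))) * ·) = (g w).map (·⁻¹) := by
    by_contra hX
    obtain ⟨d, -, hd⟩ := H22 hUfin hS₀'U hfb hfg hub hug Complex.one_re (fun h => hX h.2)
    rw [hLL] at hd
    exact hnolim d hd
  -- Step 8: conclusion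
  filter_upwards [hXb, hUfin.compl_mem_cofinite] with w hXw hwU α α' hα hα'
  have hwS : w ∉ S := fun h => hwU (hSU h)
  have hwS' : w ∉ S' := fun h => hwU (hS'U h)
  have hba : b w = a w := by
    rw [sub_self, Complex.cpow_zero, hg w, hinvconj w hwS, map_one_mul] at hXw
    exact hXw
  have e1 : α = (a w).map (((w.residueCard : ℂ) ^ s) * ·) := (hiff w hwS α).1 hα
  have e2 : α' = (b w).map (((w.residueCard : ℂ) ^ s) * ·) := by
    rw [(hiff' w hwS' α').1 hα', hb w, map_cpow_mul_map_cpow_mul (hq w), add_sub_cancel]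
  rw [e1, e2, hba]

/-- **`JacquetShalika_eq_of_rsData_eq` from (2.2) for Borel–Jacquet data and the single `L²` leaf
of (2.3).** As `JacquetShalika_eq_of_rsData_eq_of_boundary_of_pole_repData`, with
`JacquetShalika1981_partialPairL_pole_repData` supplied by its `L²` form
`JacquetShalika1981_partialPairL_pole_of_eq_conj` (every rank, field and automorphic measure) through
the landed `JacquetShalika1981_partialPairL_pole_repData_of_pole_of_eq_conj`
(`PairLFunctionPolesRepDataHolds`). [cite: Gelbart1997, Thm. 5.3.3 and §7.1 p. 257]
[cite: ArthurClozelAMS120, Ch. 3 §2 (2.2)–(2.3), p. 171] -/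
theorem JacquetShalika_eq_of_rsData_eq_of_boundary_repData_of_pole_of_eq_conj
    (h22 : JacquetShalika1981_partialPairL_boundary_repData)
    (h23 : ∀ {n : ℕ} {K : Type} [Field K] [NumberField K] {μ : Measure (gl n K).automorphicQuotient}
      [(gl n K).IsAutomorphicMeasure μ],
      JacquetShalika1981_partialPairL_pole_of_eq_conj (n := n) (K := K) (μ := μ)) :
    JacquetShalika_eq_of_rsData_eq :=
  JacquetShalika_eq_of_rsData_eq_of_boundary_of_pole_repData h22
    (JacquetShalika1981_partialPairL_pole_repData_of_pole_of_eq_conj h23)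

end Main

end Literature.NumberTheory.Automorphic
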